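import Literature.Analysis.FluidPDE.SereginSverakAxisymmetric
import HarnessLib

/-!
# Seregin–Šverák 2009, Proposition 3.7: the printed proof, decomposed

Sibling file of `SereginSverakAxisymmetric.lean`, which vendors Proposition 3.7 of G. Seregin,
V. Šverák, *On Type I singularities of the local axi-symmetric solutions of the Navier–Stokes
equations*, Comm. PDE 34 (2009) 171–201 = arXiv:0804.1803 (page references are to the arXiv
version) as the named fact `SereginSverak2009.AxisDecayBound`: under the hypotheses of Thm. 3.1
(axially symmetric distributional solution `(v, q)` in `Q = 𝒞 × ]-1, 0[`, `v ∈ L³(Q)`,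
`q ∈ L^{3/2}(Q)`, Type I bound `|v| ≤ C/√(-t)`), `|x'| |v(x,t)| ≤ C₁` (a.e.) on `Q(1/8)`.

This file follows the printed proof of Prop. 3.7 (arXiv p. 10) line by line. That proof has two
inputs — Lemma 3.5 (the scaled energy bound, vendored as `SereginSverak2009.ScaledEnergyBound`)
and an off-axis `L_∞` bound imported from Seregin–Zajaczkowski 2007 ([S11] of the paper) — and a
short scaling/covering argument. We vendor the second input, exactly in the form the paper prints
it after undoing the scaling, as the named fact `SereginSverak2009.OffAxisBound`, and we PROVE
the covering argument: `SereginSverak2009.axisDecayBound_of_offAxisBound :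
ScaledEnergyBound → OffAxisBound → AxisDecayBound`. The unconditional discharge
`AxisDecayBound_holds` therefore reduces to `ScaledEnergyBound_holds` (Lemma 3.5: App. II Moser
iteration, local energy inequality, pressure decay) and `OffAxisBound_holds` (Seregin–Zajaczkowski
2007, Prop. 4.1, resting on the Caffarelli–Kohn–Nirenberg ε-regularity theory), neither of which
is in Mathlib or in the tree; they are not attempted here.

## The printed proof (arXiv:0804.1803, p. 10)

> *Proof.* In view of (Lemma 3.5), we can argue essentially as in [S11]. Let us fix a point
> `x₀ ∈ 𝒞(1/8)` and put `r₀ = |x₀'|`, `b₀ = x₀₃`. So, we have `r₀ < 1/8` and `|b₀| < 1/8`.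
> Further, we introduce the following cylinders:
> `𝒫¹_{r₀} = {r₀ < |x'| < 2r₀, |x₃| < r₀}`, `𝒫²_{r₀} = {r₀/4 < |x'| < 3r₀, |x₃| < 2r₀}`,
> `𝒫¹_{r₀}(b₀) = 𝒫¹_{r₀} + b₀e₃`, `𝒫²_{r₀}(b₀) = 𝒫²_{r₀} + b₀e₃`,
> `Q¹_{r₀}(b₀) = 𝒫¹_{r₀}(b₀) × ]-r₀², 0[`, `Q²_{r₀}(b₀) = 𝒫²_{r₀}(b₀) × ]-(2r₀)², 0[`.
> Now, let us scale our functions so that `x = r₀y + b₀e₃`, `t = r₀²s`, `u(y,s) = r₀v(x,t)`,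
> `p(y,s) = r₀²q(x,t)`. As it was shown in [S11], there exists a continuous nondecreasing function
> `Φ : ℝ₊ → ℝ₊` such that
> `sup_{(y,s) ∈ Q¹₁(0)} |u(y,s)| + |∇u(y,s)| ≤ Φ( sup_{-2²<s<0} ∫_{𝒫²₁(0)} |u|² dy
>   + ∫_{Q²₁(0)} |∇u|² dy ds + ∫_{Q²₁(0)} |u|³ dy ds + ∫_{Q²₁(0)} |p|^{3/2} dy ds )`.   (as15)
> After making inverse scaling in (as15), we find
> `sup_{z ∈ Q¹_{r₀}(b₀)} r₀|v(x,t)| + r₀²|∇v(x,t)| ≤ Φ(cA(z_{b₀},3r₀;v) + cE(z_{b₀},3r₀;v)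
>   + cC(z_{b₀},3r₀;v) + cD(z_{b₀},3r₀;q)) ≤ Φ(4cC₁)`.
> It remains to apply Lemma 3.5 and complete the proof of the proposition.

Here `z_b = (b e₃, 0)` and `A, E, C, D` are the functionals of §3 (p. 9), vendored as
`energyA`, `dissipationE`, `cubicC`, `pressureD`. The result quoted from [S11] is
Seregin–Zajaczkowski 2007, Prop. 4.1, (4.1): for a sufficiently smooth axially symmetric solution
`(V, P)` in `Π̃ × ]-2², 0[`, `Π̃ = Π(1/4, 3; 2) = {1/4 < |x'| < 3, |x₃| < 2}`,
`sup_{Π(1,2;1) × ]-1,0[} (|V| + |∇V|) ≤ Φ(𝒜₂)`,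
`𝒜₂ = sup_t ∫_{Π̃} |V|² + ∫∫ (|∇V|² + |V|³ + |P|^{3/2})`, with `Φ` non-decreasing and not depending
on the solution; Seregin–Šverák apply it to the axially symmetric suitable weak solution `(v, q)`
(Remark 3.4), which is smooth off the axis ("It is well-known due to Caffarelli–Kohn–Nirenberg
that if `z = (x,t)` is singular point of `v`, then there must be `x' = 0`", p. 9).

## The covering argument (proof of `axisDecayBound_of_offAxisBound`) and two details the print leaves to the reader

Given a.e. `z = (t, x) ∈ Q(1/8)`, write `ρ = |x'|`.
* If `ρ ≤ (7/4)√(-t)` the Type I hypothesis (r3) already gives `ρ|v| ≤ (7/4)√(-t)|v| ≤ (7/4)C`.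
  (The shells `Q¹_{r₀}(b₀)` only see times `-r₀² < t < 0`, so points of `Q(1/8)` with
  `|x'|² ≲ -t` are not covered by the display; (r3) covers them.)
* Otherwise pick rationals `r₀ ∈ ]max(ρ/2, √(-t)), min(ρ, 1/12)[` and
  `b₀ ∈ ]max(x₃ - r₀, -1/8), min(x₃ + r₀, 1/8)[`; then `z ∈ Q¹_{r₀}(b₀)`, `0 < r₀ < 1/8`,
  `|b₀| < 1/8`, and `3r₀ < 1/4`, `|b₀| ≤ 1/4`, so Lemma 3.5 bounds `(A+E+C+D)(z_{b₀}, 3r₀) ≤ C₁`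
  and the display gives `r₀|v(z)| ≤ Φ(C₁)`, whence `ρ|v(z)| ≤ 2Φ(C₁)`. (Choosing `r₀ < 1/12`
  rather than `r₀ = |x₀'| < 1/8` keeps `3r₀` inside the range `0 < r < 1/4` of Lemma 3.5 as
  printed.) Countably many shells are used, so the exceptional null sets add up to a null set.
The constant obtained is `max((7/4)C, 2Φ(C₁))`.

## Contents

* `SereginSverak2009.innerShell r₀ b₀` : the space–time shell `Q¹_{r₀}(b₀)` (time first), with
  `mem_innerShell`, `isOpen_innerShell`, `measurableSet_innerShell`, and
  `innerShell_subset_parCyl` (`Q¹_{r₀}(b₀) ⊆ Q(z_{b₀}, 3r₀)`, the cylinder whose functionals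
  control it);
* the named fact `SereginSverak2009.OffAxisBound` (the display after (as15));
* the proved reduction `SereginSverak2009.axisDecayBound_of_offAxisBound`.

## Rendering choices (all conclusions weaker than or equal to the printed ones)

* The point `x₀ ∈ 𝒞(1/8)` enters the display only through `r₀ = |x₀'| ∈ ]0, 1/8[` and
  `b₀ = x₀₃ ∈ ]-1/8, 1/8[`; the fact quantifies over these two numbers directly (every such pair
  comes from some `x₀ ∈ 𝒞(1/8)` off the axis, e.g. `x₀ = (r₀, 0, b₀)`).
* "`sup_{z ∈ Q¹_{r₀}(b₀)} r₀|v|`" (for the Hölder continuous representative off the axis) is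
  rendered as an a.e. bound on `Q¹_{r₀}(b₀)`; the gradient half `r₀²|∇v|` of the display is
  dropped; the continuity of `Φ` is dropped and the absolute constant `c` is absorbed into `Φ`
  (`K ↦ Φ(cK)` is again non-decreasing): the fact provides SOME non-decreasing `Φ : ℝ≥0 → ℝ≥0`,
  chosen before the solution as in [S11, Prop. 4.1], and bounds `r₀|v|` by `Φ K` whenever
  `(A+E+C+D)(z_{b₀}, 3r₀) ≤ K` (for non-decreasing `Φ` this is the printed inequality; it is
  vacuous when the functionals are infinite).
* `E` is computed through an arbitrary weak spatial gradient `G` of `v` on `Q`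
  (`HasWeakSpatialGradientOn`, as in `ScaledEnergyBound`; Remark 3.4 provides one, and any two
  agree a.e., so `E` does not depend on the choice).
* Hypotheses are those of Thm. 3.1 in the rendering of the parent file
  (`IsAxisymmetricLocalSolution`, `IsTypeIOnCyl`), under which the display is printed.

## Not here

Lemma 3.5 itself (`ScaledEnergyBound_holds`), Seregin–Zajaczkowski 2007 Prop. 4.1 for smooth
solutions in its own geometry and its proof (Lemmas 4.2–4.3, Cor. 4.4, Lemma 2.3 = ε-regularity),
the Navier–Stokes scaling `v ↦ r₀ v(r₀ y + b₀ e₃, r₀² s)` of distributional solutions, and the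
CKN statement that off-axis points of axisymmetric suitable weak solutions are regular.

## References

* G. Seregin, V. Šverák, Comm. PDE 34 (2009) 171–201, arXiv:0804.1803: §3, p. 9 (Thm. 3.1,
  Remark 3.4, functionals `A, E, C, D`, Lemma 3.5 (as4)–(as5)), p. 10 (Prop. 3.7 (asp6), (as14),
  its proof, (as15) and the display following it). [`SereginSverak2009`]
* G. Seregin, W. Zajaczkowski, *A sufficient condition of regularity for axially symmetric
  solutions to the Navier–Stokes equations*, SIAM J. Math. Anal. 39 (2007) 669–685,
  arXiv:math/0702720: Prop. 4.1, (4.1) (arXiv p. 5); §5 (arXiv p. 8, the same inverse scaling).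
  [`SereginZajaczkowski2007`]
-/

noncomputable section

open MeasureTheory Set Function Filter Topology TopologicalSpace
open scoped NNReal ENNReal

namespace Literature.Analysis.FluidPDE

namespace SereginSverak2009

/-- Local notation for physical space `ℝ³ = EuclideanSpace ℝ (Fin 3)`. -/
local notation "ℝ³" => EuclideanSpace ℝ (Fin 3)

/-! ### The shells `Q¹_{r₀}(b₀)` of the proof of Proposition 3.7 -/

/-- The space–time shell `Q¹_{r₀}(b₀) = 𝒫¹_{r₀}(b₀) × ]-r₀², 0[`,
`𝒫¹_{r₀}(b₀) = {x : r₀ < |x'| < 2r₀, |x₃ - b₀| < r₀}` of the proof of Seregin–Šverák 2009,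
Prop. 3.7 (arXiv p. 10), written time first; `|x'| = cylRadius x`. Empty for `r₀ ≤ 0`.
[cite: SereginSverak2009, proof of Prop. 3.7 (arXiv p. 10)] -/
def innerShell (r₀ b₀ : ℝ) : Set (ℝ × ℝ³) :=
  {z | z.1 ∈ Ioo (-r₀ ^ 2) 0 ∧ cylRadius z.2 ∈ Ioo r₀ (2 * r₀) ∧ |z.2 2 - b₀| < r₀}

/-- Membership in `Q¹_{r₀}(b₀)`, unfolded. [cite: SereginSverak2009, proof of Prop. 3.7 (arXiv p. 10)] -/
theorem mem_innerShell {r₀ b₀ : ℝ} {z : ℝ × ℝ³} :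
    z ∈ innerShell r₀ b₀ ↔
      z.1 ∈ Ioo (-r₀ ^ 2) 0 ∧ cylRadius z.2 ∈ Ioo r₀ (2 * r₀) ∧ |z.2 2 - b₀| < r₀ :=
  Iff.rfl

/-- The shells `Q¹_{r₀}(b₀)` are open. [folklore] -/
theorem isOpen_innerShell (r₀ b₀ : ℝ) : IsOpen (innerShell r₀ b₀) := by
  have h1 : Continuous fun z : ℝ × ℝ³ => cylRadius z.2 := continuous_cylRadius.comp continuous_snd
  have h2 : Continuous fun z : ℝ × ℝ³ => |z.2 2 - b₀| := by fun_prop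
  exact (isOpen_Ioo.preimage continuous_fst).inter
    ((isOpen_Ioo.preimage h1).inter (isOpen_lt h2 continuous_const))

/-- The shells `Q¹_{r₀}(b₀)` are measurable. [folklore] -/
theorem measurableSet_innerShell (r₀ b₀ : ℝ) : MeasurableSet (innerShell r₀ b₀) :=
  (isOpen_innerShell r₀ b₀).measurableSet

/-- Translating by `b e₃` does not change the distance to the axis. [folklore] -/
theorem cylRadius_sub_smul_eZ (x : ℝ³) (b : ℝ) : cylRadius (x - b • eZ) = cylRadius x := by
  simp [cylRadius, eZ]

/-- `Q¹_{r₀}(b₀) ⊆ Q(z_{b₀}, 3r₀)`, `z_{b₀} = (b₀ e₃, 0)`: the shell lies in the parabolic cylinder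
whose functionals `A, E, C, D` control it in the proof of Prop. 3.7 (`2r₀ ≤ 3r₀`, `r₀ ≤ 3r₀`,
`-9r₀² ≤ -r₀²`). [cite: SereginSverak2009, proof of Prop. 3.7 (arXiv p. 10)] -/
theorem innerShell_subset_parCyl {r₀ : ℝ} (hr : 0 ≤ r₀) (b₀ : ℝ) :
    innerShell r₀ b₀ ⊆ parCyl ((0 : ℝ), b₀ • eZ) (3 * r₀) := by
  intro z hz
  rw [mem_innerShell] at hz
  rw [mem_parCyl]
  refine ⟨⟨by nlinarith [hz.1.1], by simpa using hz.1.2⟩, ?_, ?_⟩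
  · rw [cylRadius_sub_smul_eZ]
    linarith [hz.2.1.2]
  · have h2 : (b₀ • eZ : ℝ³) 2 = b₀ := by simp [eZ]
    rw [h2]
    linarith [hz.2.2]

/-! ### The off-axis bound of the proof of Proposition 3.7, as a named fact -/

/-- **Seregin–Šverák 2009, proof of Proposition 3.7, the display after (as15)** (arXiv:0804.1803,
p. 10; the inequality is Seregin–Zajaczkowski 2007, Prop. 4.1, (4.1) — stated there for
sufficiently smooth axially symmetric solutions in `Π(1/4,3;2) × ]-2²,0[`, with a non-decreasing
`Φ` not depending on the solution — applied to the rescaled `u(y,s) = r₀ v(r₀y + b₀e₃, r₀²s)`,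
`p = r₀² q` and scaled back). Under the conditions of Theorem 3.1, for `x₀ ∈ 𝒞(1/8)` with
`r₀ = |x₀'| > 0`, `b₀ = x₀₃` ("so, we have `r₀ < 1/8` and `|b₀| < 1/8`"):
"there exists a continuous nondecreasing function `Φ : ℝ₊ → ℝ₊` such that [(as15)] … After making
inverse scaling in (as15), we find
`sup_{z ∈ Q¹_{r₀}(b₀)} r₀|v(x,t)| + r₀²|∇v(x,t)| ≤ Φ(cA(z_{b₀},3r₀;v) + cE(z_{b₀},3r₀;v) +
cC(z_{b₀},3r₀;v) + cD(z_{b₀},3r₀;q))`", `z_{b₀} = (b₀e₃, 0)`.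
Rendered (module docstring): `(r₀, b₀) ∈ ]0,1/8[ × ]-1/8,1/8[` in place of `x₀`; SOME
non-decreasing `Φ : ℝ≥0 → ℝ≥0` chosen before the solution, `c` absorbed into `Φ`, continuity
dropped; the bound `r₀ ‖v‖ ≤ Φ K` almost everywhere on `Q¹_{r₀}(b₀)` (`innerShell r₀ b₀`) whenever
`(A+E+C+D)(z_{b₀}, 3r₀) ≤ K`, `E` through any weak spatial gradient `G` of `v` on `Q`; the
gradient half of the display is not recorded.
[cite: SereginSverak2009, proof of Prop. 3.7, (as15) and the display after it (arXiv p. 10)] -/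
def OffAxisBound : Prop :=
  ∃ Φ : ℝ≥0 → ℝ≥0, Monotone Φ ∧
    ∀ (u : ℝ → ℝ³ → ℝ³) (p : ℝ → ℝ³ → ℝ), IsAxisymmetricLocalSolution u p → IsTypeIOnCyl u →
      ∀ G : ℝ → ℝ³ → ℝ³ →L[ℝ] ℝ³, HasWeakSpatialGradientOn (parCylOpens 0 1) u G →
        ∀ r₀ ∈ Ioo (0 : ℝ) (1 / 8), ∀ b₀ : ℝ, |b₀| < 1 / 8 → ∀ K : ℝ≥0,
          energyA ((0 : ℝ), b₀ • eZ) (3 * r₀) u + dissipationE ((0 : ℝ), b₀ • eZ) (3 * r₀) G +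
              cubicC ((0 : ℝ), b₀ • eZ) (3 * r₀) u + pressureD ((0 : ℝ), b₀ • eZ) (3 * r₀) p ≤ K →
            ∀ᵐ z ∂(volume.restrict (innerShell r₀ b₀)), r₀ * ‖u z.1 z.2‖ ≤ Φ K

/-! ### Proved: Proposition 3.7 from Lemma 3.5 and the off-axis bound -/

/-- **Seregin–Šverák 2009, Proposition 3.7, assembled as printed** (arXiv p. 10, "It remains to
apply Lemma 3.5 and complete the proof of the proposition"): the scaled energy bound of Lemma 3.5
(`ScaledEnergyBound`) and the off-axis bound imported from Seregin–Zajaczkowski 2007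
(`OffAxisBound`) give `|x'| |v| ≤ C₁` a.e. on `Q(1/8)` (`AxisDecayBound`). Proof: for a.e.
`z = (t, x) ∈ Q(1/8)` with `ρ = |x'|`, either `ρ ≤ (7/4)√(-t)` and the Type I bound gives
`ρ|v| ≤ (7/4)C`, or `z` lies in a shell `Q¹_{r₀}(b₀)` with rational `ρ/2 < r₀ < ρ`, `r₀ < 1/12`,
`|b₀| < 1/8`, on which `r₀|v| ≤ Φ(C₁)` by the two facts (`3r₀ < 1/4`, `|b₀| ≤ 1/4` for Lemma 3.5),
so `ρ|v| ≤ 2Φ(C₁)`; countably many shells suffice (module docstring).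
[cite: SereginSverak2009, Prop. 3.7 and its proof (arXiv p. 10)] -/
theorem axisDecayBound_of_offAxisBound (h35 : ScaledEnergyBound) (hoff : OffAxisBound) :
    AxisDecayBound := by
  intro u p hsol hI
  obtain ⟨G, hG, C₁, hC₁⟩ := h35 u p hsol hI
  obtain ⟨Φ, -, hΦ⟩ := hoff
  have hΦu := hΦ u p hsol hI G hG
  obtain ⟨C, hC⟩ := hI
  -- the off-axis bound on every admissible rational shell, as an a.e. statement on `ℝ × ℝ³`
  have hshell : ∀ q : ℚ × ℚ, (0 : ℝ) < q.1 → (q.1 : ℝ) < 1 / 12 → |(q.2 : ℝ)| < 1 / 8 →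
      ∀ᵐ z ∂(volume : Measure (ℝ × ℝ³)), z ∈ innerShell (q.1 : ℝ) (q.2 : ℝ) →
        (q.1 : ℝ) * ‖u z.1 z.2‖ ≤ Φ C₁ := by
    intro q h0 h12 hb
    have hr : (q.1 : ℝ) ∈ Ioo (0 : ℝ) (1 / 8) := ⟨h0, by linarith⟩
    have hK := hC₁ (q.2 : ℝ) (by linarith [hb]) (3 * (q.1 : ℝ)) ⟨by linarith, by linarith⟩
    exact (ae_restrict_iff' (measurableSet_innerShell _ _)).1 (hΦu _ hr _ hb C₁ hK)
  have hall : ∀ᵐ z ∂(volume : Measure (ℝ × ℝ³)), ∀ q : ℚ × ℚ, (0 : ℝ) < q.1 → (q.1 : ℝ) < 1 / 12 →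
      |(q.2 : ℝ)| < 1 / 8 → z ∈ innerShell (q.1 : ℝ) (q.2 : ℝ) →
        (q.1 : ℝ) * ‖u z.1 z.2‖ ≤ Φ C₁ := by
    rw [ae_all_iff]
    intro q
    by_cases h : (0 : ℝ) < q.1 ∧ (q.1 : ℝ) < 1 / 12 ∧ |(q.2 : ℝ)| < 1 / 8
    · filter_upwards [hshell q h.1 h.2.1 h.2.2] with z hz _ _ _ using hz
    · exact Eventually.of_forall fun z h1 h2 h3 => absurd ⟨h1, h2, h3⟩ h
  -- the Type I bound, as an a.e. statement on `ℝ × ℝ³`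
  have hI' : ∀ᵐ z ∂(volume : Measure (ℝ × ℝ³)), z ∈ parCyl 0 1 →
      Real.sqrt (-z.1) * ‖u z.1 z.2‖ ≤ C :=
    (ae_restrict_iff' (isOpen_parCyl 0 1).measurableSet).1 hC
  refine ⟨max (7 / 4 * C) (2 * Φ C₁), (ae_restrict_iff' (isOpen_parCyl 0 (1 / 8)).measurableSet).2 ?_⟩
  filter_upwards [hall, hI'] with z hz hzI hz8
  obtain ⟨⟨ht1, ht2⟩, hρ, hx3⟩ := mem_parCyl_zero.1 hz8
  have hTI : Real.sqrt (-z.1) * ‖u z.1 z.2‖ ≤ C :=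
    hzI (parCyl_mono 0 (by norm_num) (by norm_num) hz8)
  by_cases hcase : cylRadius z.2 ≤ 7 / 4 * Real.sqrt (-z.1)
  · -- near the axis relative to the parabolic scaling: the Type I bound suffices
    calc cylRadius z.2 * ‖u z.1 z.2‖ ≤ 7 / 4 * Real.sqrt (-z.1) * ‖u z.1 z.2‖ :=
          mul_le_mul_of_nonneg_right hcase (norm_nonneg _)
      _ = 7 / 4 * (Real.sqrt (-z.1) * ‖u z.1 z.2‖) := by ring
      _ ≤ 7 / 4 * C := mul_le_mul_of_nonneg_left hTI (by norm_num)
      _ ≤ max (7 / 4 * C) (2 * Φ C₁) := le_max_left _ _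
  · -- off the axis: a rational shell `Q¹_{r₀}(b₀)` through `z`
    push Not at hcase
    have hsqrt0 : 0 ≤ Real.sqrt (-z.1) := Real.sqrt_nonneg _
    have hrange : max (cylRadius z.2 / 2) (Real.sqrt (-z.1)) < min (cylRadius z.2) (1 / 12) :=
      max_lt (lt_min (by linarith) (by linarith)) (lt_min (by linarith) (by linarith))
    obtain ⟨r, hr1, hr2⟩ := exists_rat_btwn hrange
    have hr_half : cylRadius z.2 / 2 < r := lt_of_le_of_lt (le_max_left _ _) hr1
    have hr_sqrt : Real.sqrt (-z.1) < r := lt_of_le_of_lt (le_max_right _ _) hr1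
    have hr_rho : (r : ℝ) < cylRadius z.2 := lt_of_lt_of_le hr2 (min_le_left _ _)
    have hr_12 : (r : ℝ) < 1 / 12 := lt_of_lt_of_le hr2 (min_le_right _ _)
    have hr_pos : (0 : ℝ) < r := lt_of_le_of_lt hsqrt0 hr_sqrt
    obtain ⟨hx3l, hx3r⟩ := abs_lt.1 hx3
    have hbrange : max (z.2 2 - r) (-(1 / 8)) < min (z.2 2 + r) (1 / 8) :=
      max_lt (lt_min (by linarith) (by linarith)) (lt_min (by linarith) (by norm_num))
    obtain ⟨b, hb1, hb2⟩ := exists_rat_btwn hbrange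
    have hb_lo : z.2 2 - r < b := lt_of_le_of_lt (le_max_left _ _) hb1
    have hb_lo' : -(1 / 8) < (b : ℝ) := lt_of_le_of_lt (le_max_right _ _) hb1
    have hb_hi : (b : ℝ) < z.2 2 + r := lt_of_lt_of_le hb2 (min_le_left _ _)
    have hb_hi' : (b : ℝ) < 1 / 8 := lt_of_lt_of_le hb2 (min_le_right _ _)
    have hb_abs : |(b : ℝ)| < 1 / 8 := abs_lt.2 ⟨by linarith, hb_hi'⟩
    have hmem : z ∈ innerShell (r : ℝ) (b : ℝ) := by
      refine ⟨⟨?_, ht2⟩, ⟨hr_rho, by linarith⟩, abs_sub_lt_iff.2 ⟨by linarith, by linarith⟩⟩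
      have h1 : -z.1 < (r : ℝ) ^ 2 := (Real.sqrt_lt' hr_pos).1 hr_sqrt
      linarith
    have key : (r : ℝ) * ‖u z.1 z.2‖ ≤ Φ C₁ := hz (r, b) hr_pos hr_12 hb_abs hmem
    calc cylRadius z.2 * ‖u z.1 z.2‖ ≤ 2 * r * ‖u z.1 z.2‖ :=
          mul_le_mul_of_nonneg_right (by linarith) (norm_nonneg _)
      _ = 2 * ((r : ℝ) * ‖u z.1 z.2‖) := by ring
      _ ≤ 2 * Φ C₁ := by linarith
      _ ≤ max (7 / 4 * C) (2 * Φ C₁) := le_max_right _ _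

end SereginSverak2009

end Literature.Analysis.FluidPDE
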